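import Literature.NumberTheory.NumberFields.BhargavaQuinticSpaceSyzygy
import Literature.NumberTheory.NumberFields.BhargavaQuinticSpaceQuadrics
import Mathlib.FieldTheory.Separable
import HarnessLib

/-!
# Bhargava's quintic space: the KEY lemma — equal zero loci ⟹ same rational orbit

Support file for the named fact
`Literature.NumberTheory.NumberFields.BhargavaQuinticSpace.WrightYukie1992_orbit_bijective_etaleQuintic`
(file `BhargavaQuinticSpace.lean`), towards part (b), direction ⟸.  Everything here is PROVED.

**KEY lemma** (`exists_smul_eq_of_geomZeroLocus_eq`): two non-degenerate `A, A' ∈ V(k)`, `char k = 0`,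
with the same geometric zero locus `Z_A(k̄) = Z_{A'}(k̄)` lie in the same `GL₄(k) × GL₅(k)`-orbit,
in fact `A' = (ν · 1, g₅) • A`.  This is a `k`-RATIONAL and elementary replacement for the
"single open orbit + Galois cohomology" argument of Wright–Yukie [Yukie1993, §0.4]: over `k̄`,

1. `Q(A') = M Q(A)` for an invertible `M` (quadrics through the five points,
   `exists_matrix_subPfaffian_eq`);
2. every linear syzygy of `Q(A)` is a row of the pencil `A(t)`
   (`syzSpanned_baseChange_of_isNondegenerate`, transported from the base point `A_{T⁵-1}` by a
   frame transformation and a basis change of quadrics);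
3. the rows of `A'(t) M` are syzygies of `Q(A)`, so `A'(t) M = C A(t)` with `C` invertible;
4. `N = Cᵀ M` has every `Q(A)(t)` as an eigenvector (left kernels of `A(t)`), hence `N = ν · 1`
   (eigenvector lemma), so `A'(t) = ν M⁻ᵀ A(t) M⁻¹`;
5. `M` is `Gal(k̄/k)`-invariant by uniqueness, hence `k`-rational
   (`InfiniteGalois.mem_range_algebraMap_iff_fixed`), and so is `ν`; injectivity of base change
   gives the identity in `V(k)`.

## References

* M. Bhargava, *Higher composition laws IV*, Ann. of Math. 167 (2008), 53–94, §2, §4 p. 64. [Bhargava2008]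
* A. Yukie, *Shintani Zeta Functions*, LMS LNS 183, CUP (1993), §0.4 Thm (0.4.2). [Yukie1993]
-/

noncomputable section

open Matrix
open scoped LinearAlgebra.Projectivization

namespace Literature.NumberTheory.NumberFields
namespace BhargavaQuinticSpace

universe u

/-! ### Auxiliary linear algebra -/

section KeyAux

variable {K : Type*} [Field K]

/-- Coefficients with respect to a linearly independent family are unique. [folklore] -/
theorem coeff_unique_of_linearIndependent {ι V : Type*} [Fintype ι] [AddCommGroup V] [Module K V]
    {v : ι → V} (hv : LinearIndependent K v) {a b : ι → K} (h : ∑ i, a i • v i = ∑ i, b i • v i) :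
    a = b := by
  have h0 : ∑ i, (a i - b i) • v i = 0 := by
    simp only [sub_smul, Finset.sum_sub_distrib, h, sub_self]
  funext i
  exact sub_eq_zero.mp (Fintype.linearIndependent_iff.mp hv _ h0 i)

/-- If `Q(A') = M Q(A)` and `Q(A) = M' Q(A')` with `Q(A')` independent, then `M M' = 1`. [folklore] -/
theorem matrix_mul_eq_one_of_quadrics (x y : BhargavaQuinticSpace K)
    (hyli : LinearIndependent K (fun i : Fin 5 => (subPfaffian y i : (Fin 4 → K) → K)))
    (M M' : Matrix (Fin 5) (Fin 5) K)
    (hM : ∀ i t, subPfaffian y i t = ∑ j, M i j * subPfaffian x j t)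
    (hM' : ∀ i t, subPfaffian x i t = ∑ j, M' i j * subPfaffian y j t) : M * M' = 1 := by
  ext i l
  have key : (fun l => (M * M') i l) = fun l => (1 : Matrix (Fin 5) (Fin 5) K) i l := by
    apply coeff_unique_of_linearIndependent hyli
    funext t
    simp only [Finset.sum_apply, Pi.smul_apply, smul_eq_mul, Matrix.mul_apply, Matrix.one_apply,
      ite_mul, one_mul, zero_mul, Finset.sum_ite_eq, Finset.mem_univ, if_true]
    rw [hM i t]
    simp_rw [hM' _ t, Finset.mul_sum, Finset.sum_mul]
    rw [Finset.sum_comm]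
    refine Finset.sum_congr rfl fun l _ => Finset.sum_congr rfl fun j _ => by ring
  exact congrFun key l

/-- The pencil determines the quadruple. [folklore] -/
theorem eq_of_pencil_eq {x y : BhargavaQuinticSpace K} (h : ∀ t, pencil x t = pencil y t) : x = y := by
  funext i
  apply Subtype.ext
  rw [← pencil_single x i, ← pencil_single y i, h]

/-- The `GL₄`-substitution preserves linear independence of the quadrics. [folklore] -/
theorem linearIndependent_subPfaffian_glFour_smul (g : GL (Fin 4) K) (x : BhargavaQuinticSpace K)
    (hli : LinearIndependent K (fun i : Fin 5 => (subPfaffian x i : (Fin 4 → K) → K))) :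
    LinearIndependent K (fun i : Fin 5 =>
      (subPfaffian (((g, (1 : GL (Fin 5) K)) : GL (Fin 4) K × GL (Fin 5) K) • x) i : (Fin 4 → K) → K)) := by
  rw [Fintype.linearIndependent_iff]
  intro c hc i
  refine Fintype.linearIndependent_iff.mp hli c ?_ i
  funext t
  have := congrFun hc (t ᵥ* ((g⁻¹ : GL (Fin 4) K) : Matrix (Fin 4) (Fin 4) K))
  simp only [Finset.sum_apply, Pi.smul_apply, smul_eq_mul, subPfaffian_glFour_smul, vecMul_vecMul,
    Units.inv_mul, vecMul_one, Pi.zero_apply] at this ⊢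
  exact this

/-- Base change along an injective ring homomorphism is injective on `V`. [folklore] -/
theorem map_injective {R S : Type*} [CommRing R] [CommRing S] (f : R →+* S) (hf : Function.Injective f) :
    Function.Injective (map f : BhargavaQuinticSpace R → BhargavaQuinticSpace S) := by
  intro x y h
  funext i
  apply Subtype.ext
  ext a b
  have := congrArg (fun z : BhargavaQuinticSpace S => (z i : Matrix (Fin 5) (Fin 5) S) a b) h
  simp only [coe_map_apply, Matrix.map_apply] at this
  exact hf this

end KeyAux

/-! ### The KEY lemma: equal zero loci ⟹ same rational orbit -/

section Key

variable (k : Type u) [Field k] [CharZero k]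

/-- The base point `f₀ = T⁵ - 1` is separable in characteristic `0`. [folklore] -/
theorem separable_quinticPoly_fermat : (quinticPoly (0 : k) 0 0 0 (-1)).Separable := by
  have h : quinticPoly (0 : k) 0 0 0 (-1) = Polynomial.X ^ 5 - Polynomial.C 1 := by
    simp [quinticPoly, sub_eq_add_neg]
  rw [h]
  exact Polynomial.separable_X_pow_sub_C 1 (by norm_num) one_ne_zero

omit [CharZero k] in
/-- Frame data for the zero locus of a non-degenerate element, with the vanishing of its quadrics
at the frame vectors. [folklore] -/
theorem exists_frame_of_isNondegenerate {x : BhargavaQuinticSpace k} (hx : IsNondegenerate k x) :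
    ∃ (p : Fin 5 → ℙ (AlgebraicClosure k) (Fin 4 → AlgebraicClosure k)) (F : FrameData p),
      (∀ i, p i ∈ geomZeroLocus k x) ∧ (∀ P ∈ geomZeroLocus k x, ∃ i, p i = P) ∧
      ∀ i m, subPfaffian (baseChange k x) i (F.v m) = 0 := by
  classical
  haveI : Fintype (geomZeroLocus k x) := hx.finite_geomZeroLocus.fintype
  have hcard : Fintype.card (geomZeroLocus k x) = 5 := by
    rw [← Set.toFinset_card, ← Set.ncard_eq_toFinset_card', hx.2.1]
  let e : geomZeroLocus k x ≃ Fin 5 := Fintype.equivFinOfCardEq hcard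
  let p : Fin 5 → ℙ (AlgebraicClosure k) (Fin 4 → AlgebraicClosure k) := fun i => (e.symm i : _)
  have hp : IndepFour p := indepFour_of_inGeneralPosition hx.2.2
    (Subtype.val_injective.comp e.symm.injective) fun i => (e.symm i).2
  refine ⟨p, frameData hp, fun i => (e.symm i).2, fun P hP => ⟨e ⟨P, hP⟩, by simp [p]⟩, fun i m => ?_⟩
  have hmem : Projectivization.mk _ ((frameData hp).v m) ((frameData hp).v_ne m) ∈ geomZeroLocus k x := by
    rw [(frameData hp).mk_v m]
    exact (e.symm m).2
  exact (mk_mem_geomZeroLocus_iff k x _ _).mp hmem i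

/-- **Every linear syzygy of the quadrics of a non-degenerate `A` is a row of the pencil.**
Transport from the base point `A_{T⁵-1}`: a frame transformation `g ∈ GL₄(k̄)` moves the five points
of `A_{T⁵-1}` onto those of `A`, so the quadrics of `(g, 1) • A` vanish at the base frame; by the
dimension count of quadrics through five general points they are an invertible recombination
`M₀ · Q(A_{T⁵-1})`, whence `SyzSpanned ((g,1) • A)` and, substituting back, `SyzSpanned A`.
[folklore] -/
theorem syzSpanned_baseChange_of_isNondegenerate {x : BhargavaQuinticSpace k} (hx : IsNondegenerate k x) :
    SyzSpanned (baseChange k x) := by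
  classical
  haveI : CharZero (AlgebraicClosure k) :=
    charZero_of_injective_algebraMap (algebraMap k (AlgebraicClosure k)).injective
  -- the base point and its frame
  set A0 : BhargavaQuinticSpace k := sectionQuintic (0 : k) 0 0 0 (-1) with hA0
  have h0 : IsNondegenerate k A0 := isNondegenerate_sectionQuintic k 0 0 0 0 (-1)
    (separable_quinticPoly_fermat k)
  have hA0bc : baseChange k A0 = sectionQuintic (0 : AlgebraicClosure k) 0 0 0 (-1) := by
    rw [hA0, baseChange_sectionQuintic]
    simp
  have hsyz0 : SyzSpanned (baseChange k A0) := by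
    rw [hA0bc]
    exact syzSpanned_sectionQuintic_fermat
  obtain ⟨p0, F0, -, -, hv0⟩ := exists_frame_of_isNondegenerate k h0
  obtain ⟨p, F, hpmem, -, -⟩ := exists_frame_of_isNondegenerate k hx
  -- frame transformation
  obtain ⟨g, hg⟩ := exists_projGL_apply_eq F0 F
  set x' : BhargavaQuinticSpace (AlgebraicClosure k) :=
    ((g, (1 : GL (Fin 5) (AlgebraicClosure k))) : GL (Fin 4) (AlgebraicClosure k) × GL (Fin 5) _) •
      baseChange k x with hx'
  -- the quadrics of `x'` vanish at the base frame
  have hvx' : ∀ i m, subPfaffian x' i (F0.v m) = 0 := by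
    intro i m
    rw [hx', subPfaffian_glFour_smul]
    have hmem : Projectivization.mk _ (F0.v m ᵥ* (g : Matrix (Fin 4) (Fin 4) (AlgebraicClosure k)))
        (fun h0 => F0.v_ne m (Matrix.vecMul_injective_of_isUnit (Units.isUnit g)
          (by simpa using h0))) ∈ geomZeroLocus k x := by
      have := hg m
      rw [← F0.mk_v m, projGL_mk] at this
      rw [this]
      exact hpmem m
    exact (mk_mem_geomZeroLocus_iff k x _ _).mp hmem i
  have hli' : LinearIndependent (AlgebraicClosure k)
      (fun i : Fin 5 => (subPfaffian x' i : (Fin 4 → AlgebraicClosure k) → AlgebraicClosure k)) :=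
    linearIndependent_subPfaffian_glFour_smul g _ hx.1
  -- basis change of quadrics
  obtain ⟨M0, hM0⟩ := exists_matrix_subPfaffian_eq F0 (baseChange k A0) x' h0.1 hv0 hvx'
  obtain ⟨M0', hM0'⟩ := exists_matrix_subPfaffian_eq F0 x' (baseChange k A0) hli' hvx' hv0
  have hunit : IsUnit M0 := by
    have hmul := matrix_mul_eq_one_of_quadrics (baseChange k A0) x' hli' M0 M0' hM0 hM0'
    rw [Matrix.isUnit_iff_isUnit_det]
    have := congrArg Matrix.det hmul
    rw [det_mul, det_one] at this
    exact IsUnit.of_mul_eq_one _ this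
  have hsyz' : SyzSpanned x' :=
    syzSpanned_of_quadrics_eq x' (baseChange k A0) hsyz0 h0.1 hli' M0 hunit hM0
  -- substitute back
  have hback : baseChange k x =
      ((g⁻¹, (1 : GL (Fin 5) (AlgebraicClosure k))) : GL (Fin 4) (AlgebraicClosure k) × GL (Fin 5) _) • x' := by
    rw [hx', smul_smul, Prod.mk_mul_mk, inv_mul_cancel, mul_one]
    exact (one_smul _ _).symm
  rw [hback]
  exact syzSpanned_glFour_smul g⁻¹ x' hsyz'

end Key

section Key2

variable (k : Type u) [Field k] [CharZero k]

/-- Uniqueness of the recombination matrix: if `Q(A')(t) = ∑ M i j Q(A)(t)` for two matrices,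
they agree (independence of the `Q(A)ⱼ`). [folklore] -/
theorem matrix_unique_of_quadrics {K : Type*} [Field K] (x y : BhargavaQuinticSpace K)
    (hxli : LinearIndependent K (fun i : Fin 5 => (subPfaffian x i : (Fin 4 → K) → K)))
    {M N : Matrix (Fin 5) (Fin 5) K}
    (hM : ∀ i t, subPfaffian y i t = ∑ j, M i j * subPfaffian x j t)
    (hN : ∀ i t, subPfaffian y i t = ∑ j, N i j * subPfaffian x j t) : M = N := by
  ext i j
  have key : (fun j => M i j) = fun j => N i j := by
    apply coeff_unique_of_linearIndependent hxli
    funext t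
    simp only [Finset.sum_apply, Pi.smul_apply, smul_eq_mul]
    rw [← hM i t, ← hN i t]
  exact congrFun key j

/-- **The KEY lemma.** Two non-degenerate `A, A' ∈ V(k)` (`char k = 0`) with the SAME geometric zero
locus `Z_A(k̄) = Z_{A'}(k̄)` lie in the same `GL₄(k) × GL₅(k)`-orbit; indeed `A' = (ν · 1, g₅) • A`.
Proof: `Q(A') = M Q(A)` (quadrics through the five points), the rows of `A'(t) M` are linear
syzygies of `Q(A)` hence `A'(t) M = C A(t)` (`SyzSpanned`), `C` is invertible, `N = Cᵀ M` has
every `Q(A)(t)` as an eigenvector (left kernels) hence is a scalar `ν` (eigenvector lemma), so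
`A'(t) = ν M⁻ᵀ A(t) M⁻¹`; finally `M` is `Gal(k̄/k)`-invariant (uniqueness), hence `k`-rational, and
so is `ν`. [cite: Yukie1993, §0.4 Thm (0.4.2); Bhargava2008, §2] -/
theorem exists_smul_eq_of_geomZeroLocus_eq {x y : BhargavaQuinticSpace k}
    (hx : IsNondegenerate k x) (hy : IsNondegenerate k y)
    (hZ : geomZeroLocus k x = geomZeroLocus k y) :
    ∃ g : GL (Fin 4) k × GL (Fin 5) k, g • x = y := by
  classical
  haveI : CharZero (AlgebraicClosure k) :=
    charZero_of_injective_algebraMap (algebraMap k (AlgebraicClosure k)).injective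
  set K := AlgebraicClosure k with hKdef
  set xb := baseChange k x with hxb
  set yb := baseChange k y with hyb
  -- Step 1: the recombination matrix `M` with `Q(ȳ) = M Q(x̄)`, and its inverse `M'`
  obtain ⟨p, F, hpmem, -, hvx⟩ := exists_frame_of_isNondegenerate k hx
  have hvy : ∀ i m, subPfaffian yb i (F.v m) = 0 := by
    intro i m
    have hmem : Projectivization.mk _ (F.v m) (F.v_ne m) ∈ geomZeroLocus k y := by
      rw [← hZ, F.mk_v m]
      exact hpmem m
    exact (mk_mem_geomZeroLocus_iff k y _ _).mp hmem i
  obtain ⟨M, hM⟩ := exists_matrix_subPfaffian_eq F xb yb hx.1 hvx hvy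
  obtain ⟨M', hM'⟩ := exists_matrix_subPfaffian_eq F yb xb hy.1 hvy hvx
  have hMM' : M * M' = 1 := matrix_mul_eq_one_of_quadrics xb yb hy.1 M M' hM hM'
  have hM'M : M' * M = 1 := matrix_mul_eq_one_of_quadrics yb xb hx.1 M' M hM' hM
  have hMunit : IsUnit M := by
    rw [Matrix.isUnit_iff_isUnit_det]
    have := congrArg Matrix.det hMM'
    rw [det_mul, det_one] at this
    exact IsUnit.of_mul_eq_one _ this
  have hMdet : IsUnit M.det := (Matrix.isUnit_iff_isUnit_det M).mp hMunit
  have hMinv : M⁻¹ = M' := Matrix.inv_eq_right_inv hMM'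
  -- Step 2: `SyzSpanned x̄`, and the matrix `C` with `P_ȳ(t) M = C P_x̄(t)`
  have hsyz : SyzSpanned xb := syzSpanned_baseChange_of_isNondegenerate k hx
  have hrow : ∀ i : Fin 5, ∃ c : Fin 5 → K,
      postVecMul M (rowSyz yb (Pi.single i 1)) = rowSyz xb c := fun i =>
    hsyz _ (isSyzygy_postVecMul yb xb M hM (isSyzygy_rowSyz yb (Pi.single i 1)))
  choose crow hcrow using hrow
  set C : Matrix (Fin 5) (Fin 5) K := Matrix.of crow with hC
  have hPMC : ∀ t, pencil yb t * M = C * pencil xb t := by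
    intro t
    apply Matrix.ext_of_single_vecMul
    intro i
    have := LinearMap.congr_fun (hcrow i) t
    rw [postVecMul_apply, rowSyz_apply, rowSyz_apply] at this
    rw [← vecMul_vecMul, this, ← vecMul_vecMul, hC]
    congr 1
    ext j
    simp [vecMul, dotProduct, Pi.single_apply]
  -- Step 3: `C` is invertible
  have hCunit : IsUnit C := by
    rw [← Matrix.vecMul_injective_iff_isUnit]
    intro d d' hdd'
    have hzero : ∀ v : Fin 5 → K, v ᵥ* C = 0 → v = 0 := by
      intro v hv
      apply eq_zero_of_forall_vecMul_eq_zero yb hy.1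
      intro i
      have h1 : v ᵥ* (pencil yb (Pi.single i 1) * M) = 0 := by
        rw [hPMC, ← vecMul_vecMul, hv, zero_vecMul]
      rw [pencil_single] at h1
      have h2 := congrArg (fun w => w ᵥ* M') h1
      simp only [vecMul_vecMul, Matrix.mul_assoc, hMM', Matrix.mul_one, zero_vecMul] at h2
      exact h2
    have hdd'' : d ᵥ* C = d' ᵥ* C := hdd'
    have : (d - d') ᵥ* C = 0 := by rw [sub_vecMul, hdd'', sub_self]
    exact sub_eq_zero.mp (hzero _ this)
  -- Step 4: `N = Cᵀ M` has every `Q(x̄)(t)` as an eigenvector, hence is a scalar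
  set N : Matrix (Fin 5) (Fin 5) K := Cᵀ * M with hN
  have hpar : ∀ (t : Fin 4 → K) (i j : Fin 5),
      (N *ᵥ fun m => subPfaffian xb m t) i * subPfaffian xb j t =
        (N *ᵥ fun m => subPfaffian xb m t) j * subPfaffian xb i t := by
    intro t i j
    -- `v := N Q(x̄)(t)` is in the left kernel of `P_x̄(t)`
    have hQy : (fun m => subPfaffian yb m t) = M *ᵥ fun m => subPfaffian xb m t := by
      funext i'
      simp [mulVec, dotProduct, hM i' t]
    have hleft : (fun m => subPfaffian yb m t) ᵥ* pencil yb t = 0 := by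
      rw [subPfaffian_eq_subPfVec]
      exact subPfVec_vecMul_of_mem_altMatrix (pencil_mem_altMatrix yb t)
    have hPy : pencil yb t = C * pencil xb t * M' := by
      rw [← hPMC, Matrix.mul_assoc, hMM', Matrix.mul_one]
    rw [hPy, hQy] at hleft
    have h3 := congrArg (fun w => w ᵥ* M) hleft
    simp only [vecMul_vecMul, Matrix.mul_assoc, hM'M, Matrix.mul_one, zero_vecMul] at h3
    -- h3 : (M *ᵥ Q) ᵥ* (C * pencil xb t) = 0
    have h4 : (N *ᵥ fun m => subPfaffian xb m t) ᵥ* pencil xb t = 0 := by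
      rw [hN, ← mulVec_mulVec, mulVec_transpose, vecMul_vecMul]
      exact h3
    exact mul_subPfVec_comm_of_vecMul_eq_zero (pencil_mem_altMatrix xb t) h4 i j
  obtain ⟨ν, hν⟩ := exists_eq_smul_one_of_mulVec_parallel xb hx.1 N hpar
  -- Step 5: `ν ≠ 0` and `P_ȳ(t) = ν • (M⁻ᵀ P_x̄(t) M⁻¹)`
  have hνne : ν ≠ 0 := by
    intro h0
    rw [h0, zero_smul] at hν
    have hNunit : IsUnit N := (Matrix.isUnit_iff_isUnit_det N).mpr (by
      rw [hN, det_mul, det_transpose]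
      exact ((Matrix.isUnit_iff_isUnit_det C).mp hCunit).mul hMdet)
    rw [hν] at hNunit
    exact not_isUnit_zero hNunit
  have hCeq : C = ν • M'ᵀ := by
    have h1 : Cᵀ = ν • M' := by
      have := congrArg (fun X => X * M') hν
      simp only [hN, Matrix.mul_assoc, hMM', Matrix.mul_one, smul_mul, Matrix.one_mul] at this
      exact this
    have := congrArg Matrix.transpose h1
    rwa [transpose_transpose, transpose_smul] at this
  have hpencil : ∀ t, pencil yb t = ν • (M'ᵀ * pencil xb t * M') := by
    intro t
    calc pencil yb t = pencil yb t * M * M' := by rw [Matrix.mul_assoc, hMM', Matrix.mul_one]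
      _ = C * pencil xb t * M' := by rw [hPMC]
      _ = ν • (M'ᵀ * pencil xb t * M') := by rw [hCeq, smul_mul, smul_mul]
  -- Step 6: descend `M` to `k`
  have hfixM : ∀ (σ : K ≃ₐ[k] K) (i j : Fin 5), σ (M i j) = M i j := by
    intro σ
    have hσ : ∀ i t, subPfaffian yb i t = ∑ j, σ (M i j) * subPfaffian xb j t := by
      intro i t
      -- write `t = σ v`
      obtain ⟨v, rfl⟩ : ∃ v, galSemilinear k σ v = t :=
        ⟨galSemilinear k σ.symm t, by funext i'; simp⟩
      rw [hyb, subPfaffian_baseChange_galSemilinear, ← hyb, hM i v, map_sum]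
      refine Finset.sum_congr rfl fun j _ => ?_
      rw [map_mul, hxb, subPfaffian_baseChange_galSemilinear]
    have := matrix_unique_of_quadrics xb yb hx.1 hM hσ
    intro i j
    exact (congrFun (congrFun this i) j).symm
  have hrange : ∀ i j, ∃ a : k, algebraMap k K a = M i j := fun i j =>
    (InfiniteGalois.mem_range_algebraMap_iff_fixed _).mpr fun σ => hfixM σ i j
  choose M₀ hM₀ using hrange
  have hM₀map : (Matrix.of M₀).map (algebraMap k K) = M := by
    ext i j
    exact hM₀ i j
  have hM₀det : (Matrix.of M₀).det ≠ 0 := by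
    intro h0
    apply hMdet.ne_zero
    have := RingHom.map_det (algebraMap k K) (Matrix.of M₀)
    rw [h0, map_zero] at this
    rw [← hM₀map]
    exact this.symm
  -- the `GL₅(k)`-element `G₅ = (M₀ᵀ)⁻¹`
  have hM₀Tdet : (Matrix.of M₀)ᵀ.det ≠ 0 := by rwa [det_transpose]
  set G₅ : GL (Fin 5) k := (Matrix.GeneralLinearGroup.mkOfDetNeZero _ hM₀Tdet)⁻¹ with hG₅
  have hG₅K : ((glBaseChange k G₅ : GL (Fin 5) K) : Matrix (Fin 5) (Fin 5) K) = M'ᵀ := by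
    rw [hG₅]
    simp only [glBaseChange, map_inv, Matrix.coe_units_inv, coe_generalLinearGroup_map,
      Matrix.GeneralLinearGroup.val_mkOfDetNeZero]
    rw [transpose_map, hM₀map, ← transpose_nonsing_inv, hMinv]
  -- Step 7: the element `w = (1, G₅) • x ∈ V(k)` has `ȳ = ν • w̄`
  set w : BhargavaQuinticSpace k := (((1 : GL (Fin 4) k), G₅) : GL (Fin 4) k × GL (Fin 5) k) • x with hw
  have hwb : ∀ i, (yb i : Matrix (Fin 5) (Fin 5) K) = ν • (baseChange k w i : Matrix (Fin 5) (Fin 5) K) := by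
    intro i
    have h1 : (yb i : Matrix (Fin 5) (Fin 5) K) = ν • (M'ᵀ * (xb i : Matrix (Fin 5) (Fin 5) K) * M') := by
      rw [← pencil_single yb i, hpencil, pencil_single]
    have h2 : (baseChange k w i : Matrix (Fin 5) (Fin 5) K) =
        M'ᵀ * (xb i : Matrix (Fin 5) (Fin 5) K) * M' := by
      rw [hw, baseChange_smul, coe_smul_apply]
      simp only [glBaseChange, map_one, Units.val_one, Matrix.one_apply, ite_smul, one_smul, zero_smul,
        Finset.sum_ite_eq, Finset.mem_univ, if_true]
      rw [← glBaseChange, hG₅K, transpose_transpose]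
    rw [h1, h2]
  -- Step 8: `ν` is `k`-rational
  have hwne : ∃ i a b, (w i : Matrix (Fin 5) (Fin 5) k) a b ≠ 0 := by
    by_contra hall
    push Not at hall
    have hw0 : ∀ i, (baseChange k w i : Matrix (Fin 5) (Fin 5) K) = 0 := by
      intro i
      ext a b
      simp [baseChange, coe_map_apply, hall i a b]
    have hy0 : ∀ i, (yb i : Matrix (Fin 5) (Fin 5) K) = 0 := fun i => by rw [hwb, hw0, smul_zero]
    -- then all quadrics of `ȳ` vanish, contradicting independence
    have : (subPfaffian yb 0 : (Fin 4 → K) → K) = 0 := by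
      funext t
      have hp0 : pencil yb t = 0 := by simp [pencil, hy0]
      simp [subPfaffian, hp0, subPfVec, pf4]
    exact hy.1.ne_zero 0 this
  obtain ⟨i₀, a₀, b₀, hne⟩ := hwne
  set ν₀ : k := (y i₀ : Matrix (Fin 5) (Fin 5) k) a₀ b₀ / (w i₀ : Matrix (Fin 5) (Fin 5) k) a₀ b₀ with hν₀
  have hνeq : algebraMap k K ν₀ = ν := by
    have h1 := congrFun (congrFun (hwb i₀) a₀) b₀
    simp only [Matrix.smul_apply, smul_eq_mul] at h1
    have h2 : (yb i₀ : Matrix (Fin 5) (Fin 5) K) a₀ b₀ = algebraMap k K ((y i₀ : Matrix (Fin 5) (Fin 5) k) a₀ b₀) := rfl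
    have h3 : (baseChange k w i₀ : Matrix (Fin 5) (Fin 5) K) a₀ b₀ =
        algebraMap k K ((w i₀ : Matrix (Fin 5) (Fin 5) k) a₀ b₀) := rfl
    rw [h2, h3] at h1
    have hne' : algebraMap k K ((w i₀ : Matrix (Fin 5) (Fin 5) k) a₀ b₀) ≠ 0 :=
      fun h => hne ((algebraMap k K).injective (by rw [h, map_zero]))
    rw [hν₀, map_div₀, h1, mul_div_assoc, div_self hne', mul_one]
  have hν₀ne : ν₀ ≠ 0 := by
    intro h0
    apply hνne
    rw [← hνeq, h0, map_zero]
  -- Step 9: conclude in `V(k)` by injectivity of base change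
  have hdet4 : (ν₀ • (1 : Matrix (Fin 4) (Fin 4) k)).det ≠ 0 := by
    rw [det_smul, det_one, mul_one]
    exact pow_ne_zero _ hν₀ne
  refine ⟨((Matrix.GeneralLinearGroup.mkOfDetNeZero _ hdet4), G₅), ?_⟩
  apply map_injective (algebraMap k K) (algebraMap k K).injective
  change baseChange k (_ • x) = yb
  have hsplit : (((Matrix.GeneralLinearGroup.mkOfDetNeZero _ hdet4), G₅) : GL (Fin 4) k × GL (Fin 5) k) =
      ((Matrix.GeneralLinearGroup.mkOfDetNeZero _ hdet4), (1 : GL (Fin 5) k)) * ((1 : GL (Fin 4) k), G₅) := by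
    rw [Prod.mk_mul_mk, mul_one, one_mul]
  rw [hsplit, mul_smul, ← hw]
  funext i
  apply Subtype.ext
  rw [hwb i, baseChange_smul, coe_smul_apply]
  have hg4 : ∀ i j : Fin 4,
      ((glBaseChange k (Matrix.GeneralLinearGroup.mkOfDetNeZero _ hdet4) : GL (Fin 4) K) :
        Matrix (Fin 4) (Fin 4) K) i j = if i = j then ν else 0 := by
    intro i j
    rw [glBaseChange, coe_generalLinearGroup_map, Matrix.map_apply,
      Matrix.GeneralLinearGroup.val_mkOfDetNeZero, Matrix.smul_apply, Matrix.one_apply]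
    split_ifs
    · rw [smul_eq_mul, mul_one, hνeq]
    · rw [smul_zero, map_zero]
  simp only [hg4, glBaseChange, map_one, Units.val_one, Matrix.one_mul, transpose_one, Matrix.mul_one,
    ite_smul, zero_smul, Finset.sum_ite_eq, Finset.mem_univ, if_true]

end Key2

end BhargavaQuinticSpace
end Literature.NumberTheory.NumberFields
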